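import Mathlib.LinearAlgebra.Contraction
import Mathlib.LinearAlgebra.Dual.Lemmas
import Mathlib.LinearAlgebra.Projection
import Mathlib.LinearAlgebra.Basis.VectorSpace
import Mathlib.LinearAlgebra.FreeModule.Finite.Basic
import HarnessLib

/-!
# The filtration of `Hom(A, B) = A^∨ ⊗ B`: the "sum of images" and "Hom" descriptions agree

Let `A` be a finite-dimensional vector space over a field `K` with a finite decreasing filtration
`F` (some `Fᵃ A = A`, some `Fᵃ A = 0`) and `B` a vector space with a decreasing filtration `G`.
P. Deligne, *Théorie de Hodge II*, 1.1.12 (p. 8–9) defines the filtration of a right exact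
multi-additive functor by sums of images, `Fᵖ(⊗ Aᵢ) = Σ_{Σ kᵢ = p} Im(⊗ F^{kᵢ} Aᵢ → ⊗ Aᵢ)`,
extends it "à des foncteurs contravariants en certaines variables par (1.1.6)" (the dual
filtration `Fˢ(A^∨) = (F^{1-s} A)^⊥`, 1.1.6–1.1.7), and for the left exact functor `Hom` sets
"`Fᵖ(Hom(A, B)) = {f : A → B | ∀ n, f(Fⁿ(A)) ⊂ F^{n+p}(B)}`. On a donc
`Hom((A, F), (B, F)) = F⁰(Hom(A, B))`", adding: "Pour `H` exact, les deux définitions sont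
équivalentes" (El Zein–Lê, Ch. 3 of Cattani–El Zein–Griffiths–Lê, *Hodge Theory*, §3.2.1.6–3.2.1.7,
p. 154: "If `H` is exact, both definitions are equivalent"). For `A` finite-dimensional,
`Hom(A, B) = A^∨ ⊗ B` is exact in both variables, and this file PROVES the asserted equivalence in
the form used by the Hodge-theory layer (`Literature/AlgebraicGeometry/Motives`): under Mathlib's
`dualTensorHom K A B : A^∨ ⊗ B → Hom(A, B)` (`φ ⊗ b ↦ (x ↦ φ(x) b)`),

* `dualTensorHom_mem_homFiltration_iff` — `T ∈ Σ_{p ≤ s+t} (F^{1-s} A)^⊥ ⊗ Gᵗ B` (Deligne's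
  tensor filtration of `A^∨ ⊗ B`, written with `≤` as in the tree's `HodgeStructure.tmulFiltration`)
  iff `dualTensorHom T` maps `Fⁿ A` into `G^{n+p} B` for every `n`;
* `dualTensorHom_mem_homFiltration_iff_of_monotone` — the same for INCREASING filtrations `W`
  (Deligne's convention `Fⁱ = W_{-i}`, El Zein–Lê §3.2.1.8; the dual filtration reads
  `W_i(A^∨) = (W_{-i-1} A)^⊥`): `T ∈ Σ_{i+j=r} (W_{-i-1} A)^⊥ ⊗ W_j B` iff `dualTensorHom T` maps
  `W_k A` into `W_{k+r} B` for every `k` (the weight filtration of the internal Hom of mixed Hodge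
  structures, El Zein–Lê §3.2.2.7 (2)(ii)).

Proof. `⊆`: a generator `ξ ⊗ y`, `ξ ⊥ F^{1-s}`, `y ∈ Gᵗ`, `p ≤ s + t`, acts by `x ↦ ξ(x) y`; for
`x ∈ Fⁿ` either `n ≥ 1 - s` and `ξ(x) = 0`, or `n + p ≤ t` and `ξ(x) y ∈ Gᵗ ⊆ G^{n+p}`. `⊇`: choose
for every `a` a projection `P_a` of `A` onto `Fᵃ` (a complement exists over a field) and put
`D_a = P_a - P_{a+1}`; then `D_a(A) ⊆ Fᵃ`, `D_a(F^{a+1}) = 0` and `Σ_a D_a = P_{c} - P_{c+k} = id`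
when `F^c = A`, `F^{c+k} = 0` (telescoping). Hence `f = Σ_a f ∘ D_a`, and if `f(Fⁿ) ⊆ G^{n+p}`
for all `n` then `f ∘ D_a` kills `F^{a+1}` with values in `G^{a+p}`, so it comes from
`(F^{a+1})^⊥ ⊗ G^{a+p} = F^{-a}(A^∨) ⊗ G^{a+p}(B)`, of total degree `p`. (The pure Hodge-structure
special case, where `F` is opposed to its conjugate and the `P_a` can be taken to be Deligne's
opposed projectors, is `Literature.AlgebraicGeometry.Motives.HodgeStructure.comap_dualTensorHom_homFiltration`;
the present file needs no second filtration.) No definition and no named fact is introduced.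

## References

* [DeligneHodgeII1971] P. Deligne, Théorie de Hodge II, Publ. Math. IHÉS 40 (1971), 1.1.6, 1.1.7,
  1.1.12 (pp. 7–9 of the journal; held text `paper:url-21dd947b3606`, pp. 4–6).
* [CattaniElZeinGriffithsLe2014] E. Cattani, F. El Zein, P. Griffiths, Lê D. T. (eds.), Hodge
  Theory, Math. Notes 49, Princeton (2014), Ch. 3 (El Zein–Lê), §3.2.1.6–3.2.1.8 (p. 154),
  §3.2.2.7 (2) (p. 163).
-/

open scoped TensorProduct

namespace Literature.LinearAlgebra.Filtration

/-! ### Plumbing over a commutative ring: naturality of `dualTensorHom` -/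

section CommRing

universe u₁ u₂ u₃ u₄ u₅

variable {K : Type u₁} [CommRing K] {M₁ : Type u₂} [AddCommGroup M₁] [Module K M₁]
  {M₂ : Type u₃} [AddCommGroup M₂] [Module K M₂] {N₁ : Type u₄} [AddCommGroup N₁] [Module K N₁]
  {N₂ : Type u₅} [AddCommGroup N₂] [Module K N₂]

/-- Naturality of `dualTensorHom`: for `D : M₁ → N₁`, `j : N₂ → M₂` and `T ∈ N₁^∨ ⊗ N₂`,
`dualTensorHom ((Dᵗ ⊗ j) T) = j ∘ dualTensorHom T ∘ D`. [folklore] -/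
private theorem dualTensorHom_map_dualMap (D : M₁ →ₗ[K] N₁) (j : N₂ →ₗ[K] M₂)
    (T : Module.Dual K N₁ ⊗[K] N₂) :
    dualTensorHom K M₁ M₂ (TensorProduct.map D.dualMap j T) =
      j ∘ₗ dualTensorHom K N₁ N₂ T ∘ₗ D := by
  induction T using TensorProduct.induction_on with
  | zero => simp only [map_zero, LinearMap.zero_comp, LinearMap.comp_zero]
  | add x y hx hy => simp only [map_add, hx, hy, LinearMap.add_comp, LinearMap.comp_add]
  | tmul ψ w =>
    refine LinearMap.ext fun x ↦ ?_
    simp [dualTensorHom_apply, LinearMap.dualMap_apply]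

end CommRing

section Field

universe u₁ u₂ u₃

variable {K : Type u₁} [Field K] {M₁ : Type u₂} [AddCommGroup M₁] [Module K M₁]
  {M₂ : Type u₃} [AddCommGroup M₂] [Module K M₂]

/-! ### Plumbing over a field: maps killing a subspace; projections onto the steps of a filtration -/

/-- A linear map killing `S` with values in `G` comes from `S^⊥ ⊗ G`: for `M₁` finite-dimensional,
`S ≤ M₁`, `G ≤ M₂` and `g : M₁ → M₂` with `g(S) = 0`, `g(M₁) ⊆ G`, there is
`T ∈ im(S^⊥ ⊗ G → M₁^∨ ⊗ M₂)` with `dualTensorHom T = g` (`g` factors through the projection onto a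
complement `C` of `S`, and `Hom(C, G) = C^∨ ⊗ G`). [folklore] -/
private theorem exists_dualTensorHom_eq_of_forall_mem [Module.Finite K M₁] (S : Submodule K M₁)
    (G : Submodule K M₂) (g : M₁ →ₗ[K] M₂) (hS : ∀ x ∈ S, g x = 0) (hG : ∀ x, g x ∈ G) :
    ∃ T ∈ LinearMap.range (TensorProduct.mapIncl S.dualAnnihilator G),
      dualTensorHom K M₁ M₂ T = g := by
  obtain ⟨C, hC⟩ := S.exists_isCompl
  obtain ⟨T₀, hT₀⟩ : ∃ T₀ : Module.Dual K C ⊗[K] G,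
      dualTensorHom K C G T₀ = (g ∘ₗ C.subtype).codRestrict G fun c ↦ hG _ :=
    ⟨_, dualTensorHomEquivOfBasis_symm_cancel_right (Module.Free.chooseBasis K C) _⟩
  have hπ : ∀ ψ : Module.Dual K C,
      (C.projectionOnto S hC.symm).dualMap ψ ∈ S.dualAnnihilator := by
    intro ψ
    rw [Submodule.mem_dualAnnihilator]
    intro s hs
    rw [LinearMap.dualMap_apply, Submodule.projectionOnto_apply_of_mem_right hC.symm hs, map_zero]
  refine ⟨TensorProduct.map S.dualAnnihilator.subtype G.subtype (TensorProduct.map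
      ((C.projectionOnto S hC.symm).dualMap.codRestrict S.dualAnnihilator hπ) LinearMap.id T₀),
    LinearMap.mem_range_self (TensorProduct.mapIncl S.dualAnnihilator G) _, ?_⟩
  rw [TensorProduct.map_map, LinearMap.subtype_comp_codRestrict, LinearMap.comp_id,
    dualTensorHom_map_dualMap, hT₀]
  refine LinearMap.ext fun x ↦ ?_
  simp only [LinearMap.comp_apply, Submodule.subtype_apply, LinearMap.codRestrict_apply,
    Submodule.coe_projectionOnto_apply]
  have hx := Submodule.projection_add_projection_eq_self hC.symm x
  calc g (C.projection S hC.symm x)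
      = g (C.projection S hC.symm x) + g (S.projection C hC.symm.symm x) := by
        rw [hS _ (Submodule.projection_apply_mem _ x), add_zero]
    _ = g x := by rw [← map_add, hx]

/-- Over a field every step of a filtration is complemented, so there is a family of projections
`P_a : M₁ → M₁` onto the `F a`: `P_a(M₁) ⊆ F a` and `P_a = id` on `F a`. [folklore] -/
private theorem exists_proj (F : ℤ → Submodule K M₁) :
    ∃ P : ℤ → M₁ →ₗ[K] M₁, (∀ a x, P a x ∈ F a) ∧ ∀ a, ∀ x ∈ F a, P a x = x := by
  have h : ∀ a, ∃ P : M₁ →ₗ[K] M₁, (∀ x, P x ∈ F a) ∧ ∀ x ∈ F a, P x = x := fun a ↦ by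
    obtain ⟨C, hC⟩ := (F a).exists_isCompl
    exact ⟨(F a).projection C hC, fun x ↦ Submodule.projection_apply_mem hC x,
      fun x hx ↦ Submodule.projection_apply_of_mem_left hC hx⟩
  choose P hP hP' using h
  exact ⟨P, hP, hP'⟩

variable {F : ℤ → Submodule K M₁} {P : ℤ → M₁ →ₗ[K] M₁}

/-- `D_a x := P_a x - P_{a+1} x ∈ F a` for a decreasing `F` (both terms lie in `F a ⊇ F (a+1)`).
[folklore] -/
private theorem proj_sub_mem (hP : ∀ a x, P a x ∈ F a) (hF : Antitone F) (a : ℤ) (x : M₁) :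
    P a x - P (a + 1) x ∈ F a :=
  sub_mem (hP a x) (hF (show a ≤ a + 1 by omega) (hP (a + 1) x))

/-- `D_a = P_a - P_{a+1}` kills `F c` for `c > a`: there both projections are the identity. [folklore] -/
private theorem proj_sub_eq_zero_of_mem (hP' : ∀ a, ∀ x ∈ F a, P a x = x) (hF : Antitone F)
    {a c : ℤ} (hc : a < c) {x : M₁} (hx : x ∈ F c) : P a x - P (a + 1) x = 0 := by
  rw [hP' a x (hF (show a ≤ c by omega) hx), hP' (a + 1) x (hF (show a + 1 ≤ c by omega) hx),
    sub_self]

/-- Telescoping: if `F c = M₁` and `F (c + k) = 0` then `Σ_{0 ≤ i < k} D_{c+i} = P_c - P_{c+k} = id`.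
[folklore] -/
private theorem sum_proj_sub (hP : ∀ a x, P a x ∈ F a) (hP' : ∀ a, ∀ x ∈ F a, P a x = x) (c : ℤ)
    (k : ℕ) (hc : F c = ⊤) (hk : F (c + k) = ⊥) (x : M₁) :
    ∑ i ∈ Finset.range k, (P (c + i) x - P (c + i + 1) x) = x := by
  have h := Finset.sum_range_sub' (fun i : ℕ ↦ P (c + i) x) k
  simp only [Nat.cast_add, Nat.cast_one, ← add_assoc, Nat.cast_zero, add_zero] at h
  rw [h, hP' c x (show x ∈ F c by simp [hc])]
  have h0 : P (c + k) x = 0 := by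
    have := hP (c + k) x
    rwa [hk, Submodule.mem_bot] at this
  rw [h0, sub_zero]

/-! ### The theorem -/

/-- **Deligne's two descriptions of the filtration on `Hom(A, B) = A^∨ ⊗ B` agree** (Hodge II,
1.1.12 with 1.1.6: "`Fᵖ(Hom(A, B)) = {f : A → B | ∀ n, f(Fⁿ(A)) ⊂ F^{n+p}(B)}` … Pour `H` exact,
les deux définitions sont équivalentes"; El Zein–Lê §3.2.1.6–3.2.1.7). For `A = M₁`
finite-dimensional over a field with a finite decreasing filtration `F` and `B = M₂` with a
decreasing filtration `G`: an element `T ∈ M₁^∨ ⊗ M₂` lies in the tensor filtration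
`Σ_{p ≤ s + t} Fˢ(M₁^∨) ⊗ Gᵗ`, `Fˢ(M₁^∨) = (F^{1-s} M₁)^⊥` (sum of images, 1.1.12, for the dual
filtration 1.1.6), if and only if the linear map `dualTensorHom T : M₁ → M₂` (`φ ⊗ y ↦ (x ↦ φ(x) y)`)
satisfies `f(Fⁿ M₁) ⊆ G^{n+p} M₂` for all `n`. [cite: DeligneHodgeII1971, 1.1.12]
[cite: CattaniElZeinGriffithsLe2014, Ch. 3 §3.2.1.6–3.2.1.7 p. 154] -/
theorem dualTensorHom_mem_homFiltration_iff [Module.Finite K M₁] {F : ℤ → Submodule K M₁}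
    {G : ℤ → Submodule K M₂} (hF : Antitone F) (hFtop : ∃ a, F a = ⊤) (hFbot : ∃ a, F a = ⊥)
    (hG : Antitone G) (p : ℤ) (T : Module.Dual K M₁ ⊗[K] M₂) :
    T ∈ ⨆ (s : ℤ) (t : ℤ) (_ : p ≤ s + t),
        LinearMap.range (TensorProduct.mapIncl (F (1 - s)).dualAnnihilator (G t)) ↔
      ∀ n, ∀ x ∈ F n, dualTensorHom K M₁ M₂ T x ∈ G (n + p) := by
  -- the right-hand side is (membership in) a submodule `S`
  let S : Submodule K (Module.Dual K M₁ ⊗[K] M₂) :=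
    { carrier := {T | ∀ n, ∀ x ∈ F n, dualTensorHom K M₁ M₂ T x ∈ G (n + p)}
      zero_mem' := fun n x _ ↦ by simp
      add_mem' := fun {T₁ T₂} h₁ h₂ n x hx ↦ by
        simpa only [map_add, LinearMap.add_apply] using add_mem (h₁ n x hx) (h₂ n x hx)
      smul_mem' := fun c {T₁} h₁ n x hx ↦ by
        simpa only [map_smul, LinearMap.smul_apply] using Submodule.smul_mem _ c (h₁ n x hx) }
  change _ ↔ T ∈ S
  constructor
  · -- `⊆`: the contraction formula on generators
    revert T
    refine fun T hT ↦ (show (⨆ (s : ℤ) (t : ℤ) (_ : p ≤ s + t),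
        LinearMap.range (TensorProduct.mapIncl (F (1 - s)).dualAnnihilator (G t))) ≤ S from ?_) hT
    refine iSup_le fun s ↦ iSup_le fun t ↦ iSup_le fun hst ↦ ?_
    rw [TensorProduct.range_mapIncl, Submodule.map₂_le]
    intro ξ hξ y hy n x hx
    rw [TensorProduct.mk_apply, dualTensorHom_apply]
    rw [Submodule.mem_dualAnnihilator] at hξ
    by_cases h : 1 - s ≤ n
    · rw [hξ x (hF h hx), zero_smul]
      exact Submodule.zero_mem _
    · exact Submodule.smul_mem _ _ (hG (show n + p ≤ t by omega) hy)
  · -- `⊇`: decompose `f = Σ_a f ∘ D_a` with projections `P_a` onto the `F a`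
    intro hT
    change ∀ n, ∀ x ∈ F n, dualTensorHom K M₁ M₂ T x ∈ G (n + p) at hT
    obtain ⟨P, hP, hP'⟩ := exists_proj F
    obtain ⟨c₀, hc₀⟩ := hFtop
    obtain ⟨c₁, hc₁⟩ := hFbot
    have hk : F (c₀ + ((c₁ - c₀).toNat : ℕ)) = ⊥ :=
      eq_bot_iff.2 ((hF (show c₁ ≤ c₀ + ((c₁ - c₀).toNat : ℕ) by omega)).trans hc₁.le)
    -- `Σ_i D_{c₀+i} = id` on `M₁`, hence `Σ_i (D_{c₀+i}ᵗ ⊗ id) = id` on `M₁^∨ ⊗ M₂`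
    have hsum : ∀ x : M₁, ∑ i ∈ Finset.range (c₁ - c₀).toNat,
        (P (c₀ + i) x - P (c₀ + i + 1) x) = x :=
      sum_proj_sub hP hP' c₀ _ hc₀ hk
    have hdecomp : ∀ T : Module.Dual K M₁ ⊗[K] M₂,
        ∑ i ∈ Finset.range (c₁ - c₀).toNat,
          TensorProduct.map (P (c₀ + i) - P (c₀ + i + 1)).dualMap LinearMap.id T = T := by
      intro T
      induction T using TensorProduct.induction_on with
      | zero => simp only [map_zero, Finset.sum_const_zero]
      | add x y hx hy => simp only [map_add, Finset.sum_add_distrib, hx, hy]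
      | tmul ξ y =>
        simp only [TensorProduct.map_tmul, LinearMap.id_apply]
        rw [← TensorProduct.sum_tmul]
        congr 1
        refine LinearMap.ext fun x ↦ ?_
        rw [LinearMap.sum_apply]
        simp only [LinearMap.dualMap_apply, LinearMap.sub_apply]
        rw [← map_sum, hsum]
    rw [← hdecomp T]
    refine Submodule.sum_mem _ fun i _ ↦ ?_
    -- `f ∘ D_a` kills `F^{a+1} = F^{1-(-a)}` and takes values in `G^{a+p}`
    have hg₁ : ∀ x ∈ F (1 - -(c₀ + (i : ℤ))), dualTensorHom K M₁ M₂
        (TensorProduct.map (P (c₀ + i) - P (c₀ + i + 1)).dualMap LinearMap.id T) x = 0 := by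
      intro x hx
      have hx' : x ∈ F (c₀ + i + 1) := by
        rwa [show (1 : ℤ) - -(c₀ + (i : ℤ)) = c₀ + i + 1 by ring] at hx
      rw [dualTensorHom_map_dualMap, LinearMap.id_comp, LinearMap.comp_apply, LinearMap.sub_apply,
        proj_sub_eq_zero_of_mem hP' hF (show c₀ + (i : ℤ) < c₀ + i + 1 by omega) hx', map_zero]
    have hg₂ : ∀ x, dualTensorHom K M₁ M₂
        (TensorProduct.map (P (c₀ + i) - P (c₀ + i + 1)).dualMap LinearMap.id T) x ∈
          G (c₀ + i + p) := by
      intro x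
      rw [dualTensorHom_map_dualMap, LinearMap.id_comp, LinearMap.comp_apply, LinearMap.sub_apply]
      exact hT (c₀ + i) _ (proj_sub_mem hP hF (c₀ + i) x)
    obtain ⟨T'', hT'', hTT⟩ := exists_dualTensorHom_eq_of_forall_mem
      (F (1 - -(c₀ + (i : ℤ)))) (G (c₀ + i + p)) _ hg₁ hg₂
    have heq : TensorProduct.map (P (c₀ + i) - P (c₀ + i + 1)).dualMap LinearMap.id T = T'' := by
      apply (dualTensorHomEquiv K M₁ M₂).injective
      simp only [dualTensorHomEquiv, dualTensorHomEquivOfBasis_apply]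
      exact hTT.symm
    rw [heq]
    exact Submodule.mem_iSup_of_mem (-(c₀ + (i : ℤ))) (Submodule.mem_iSup_of_mem (c₀ + i + p)
      (Submodule.mem_iSup_of_mem (by omega) hT''))

/-- **The increasing (weight-filtration) form.** For `M₁` finite-dimensional over a field with a
finite increasing filtration `A` and `M₂` with an increasing filtration `B` (Deligne's convention
`Fⁱ = W_{-i}` turns these into decreasing ones, El Zein–Lê §3.2.1.8; the dual filtration of 1.1.6
then reads `A_i(M₁^∨) = (A_{-i-1} M₁)^⊥`): `T ∈ Σ_{i+j=r} (A_{-i-1} M₁)^⊥ ⊗ B_j M₂` (the sum of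
images of 1.1.12) if and only if `dualTensorHom T` maps `A_k M₁` into `B_{k+r} M₂` for every `k`
(1.1.12: "`Fᵖ(Hom(A, B)) = {f | ∀ n, f(Fⁿ(A)) ⊂ F^{n+p}(B)}` … les deux définitions sont
équivalentes"). This is the weight filtration `W_r Hom(H, H') = {f | ∀ n, f(W_n H) ⊂ W_{n+r} H'}`
of the internal Hom of mixed Hodge structures (El Zein–Lê §3.2.2.7 (2)(ii), where `W_{n+2r}` is
printed — a misprint for `W_{n+r}`, as 1.1.12 with `Fⁱ = W_{-i}` shows).
[cite: DeligneHodgeII1971, 1.1.12] [cite: CattaniElZeinGriffithsLe2014, Ch. 3 §3.2.1.6–3.2.1.8 p. 154] -/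
theorem dualTensorHom_mem_homFiltration_iff_of_monotone [Module.Finite K M₁]
    {A : ℤ → Submodule K M₁} {B : ℤ → Submodule K M₂} (hA : Monotone A) (hAbot : ∃ k, A k = ⊥)
    (hAtop : ∃ k, A k = ⊤) (hB : Monotone B) (r : ℤ) (T : Module.Dual K M₁ ⊗[K] M₂) :
    T ∈ ⨆ ij ∈ {ij : ℤ × ℤ | ij.1 + ij.2 = r},
        Submodule.map₂ (TensorProduct.mk K (Module.Dual K M₁) M₂) (A (-ij.1 - 1)).dualAnnihilator
          (B ij.2) ↔
      ∀ k, ∀ x ∈ A k, dualTensorHom K M₁ M₂ T x ∈ B (k + r) := by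
  -- the decreasing filtrations `F n = A (-n)`, `G n = B (-n)`, in degree `p = -r`
  have hF : Antitone fun n ↦ A (-n) := fun _ _ h ↦ hA (by omega)
  have hG : Antitone fun n ↦ B (-n) := fun _ _ h ↦ hB (by omega)
  have hFtop : ∃ a, (fun n ↦ A (-n)) a = ⊤ := by
    obtain ⟨k, hk⟩ := hAtop
    exact ⟨-k, by simpa using hk⟩
  have hFbot : ∃ a, (fun n ↦ A (-n)) a = ⊥ := by
    obtain ⟨k, hk⟩ := hAbot
    exact ⟨-k, by simpa using hk⟩
  have key := dualTensorHom_mem_homFiltration_iff hF hFtop hFbot hG (-r) T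
  -- the two index sets describe the same subspace
  have hsup : (⨆ ij ∈ {ij : ℤ × ℤ | ij.1 + ij.2 = r},
      Submodule.map₂ (TensorProduct.mk K (Module.Dual K M₁) M₂) (A (-ij.1 - 1)).dualAnnihilator
        (B ij.2)) =
      ⨆ (s : ℤ) (t : ℤ) (_ : -r ≤ s + t), LinearMap.range (TensorProduct.mapIncl
        ((fun n ↦ A (-n)) (1 - s)).dualAnnihilator ((fun n ↦ B (-n)) t)) := by
    apply le_antisymm
    · refine iSup₂_le fun ij (hij : ij.1 + ij.2 = r) ↦ ?_
      refine le_iSup₂_of_le (-ij.1) (-ij.2) (le_iSup_of_le (by omega) ?_)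
      rw [TensorProduct.range_mapIncl]
      simp only [show -(1 - -ij.1) = -ij.1 - 1 by ring, neg_neg, le_refl]
    · refine iSup₂_le fun s t ↦ iSup_le fun hst ↦ ?_
      rw [TensorProduct.range_mapIncl]
      refine le_trans ?_ (le_biSup (fun ij : ℤ × ℤ ↦
        Submodule.map₂ (TensorProduct.mk K (Module.Dual K M₁) M₂) (A (-ij.1 - 1)).dualAnnihilator
          (B ij.2)) (i := (-s, r + s)) (show -s + (r + s) = r by ring))
      simp only [show -(-s) - 1 = -(1 - s) by ring]
      exact Submodule.map₂_le_map₂_right (hB (by omega))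
  rw [hsup, key]
  constructor
  · intro h k x hx
    have h' := h (-k) x (by simpa using hx)
    simpa [show -(-k + -r) = k + r by ring] using h'
  · intro h n x hx
    have h' := h (-n) x hx
    simpa [show -n + r = -(n + -r) by ring] using h'

end Field

end Literature.LinearAlgebra.Filtration
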